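import Summits.BirchSwinnertonDyer.Rank1Residual.GaloisImage.KolyvaginDerivativeSingularValue
import HarnessLib

/-!
# The ascent step of the Kolyvagin congruence (Perrin-Riou, *Systèmes d'Euler p-adiques*,
# Prop. 2.2.5 (ii), p. 1252 (2.2.6)–(2.2.8)) — file C0b of THEOREM C of row T-DER
# (cell `b2b-bsdres`, team n1011, seat p11 GEN 8, OWNERS row T-DER = skel/T-DER.md STATUS v8)

HONEST FRAMING (cell `b2b-bsdres`, run/shared/lean/b2b/bsd-rank1-residual/, verbatim in every
file): the goal of the cell is to DELETE the COMBINATION-SHAPED residual classes of the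
Birch–Swinnerton-Dyer formula for ALL analytic-rank `≤ 1` elliptic curves over `ℚ` — "full BSD
formula for every rank `≤ 1` curve in class `C`" assembled STRICTLY from published theorems — so
that the rank-`≤ 1` remainder becomes exactly the CONSTRUCTION-SHAPED classes, which are TYPED
(missing-input `Prop`s), NOT attempted. This is not "finishing BSD". Team n1011: research route on
the CONSTRUCTION-SHAPED class X4 / §I N11 (route-1 PORT, (P-DER)); TOOL theorems of continuous
group cohomology (no definition, no named fact, no `sorry`); curve-free, `p`-free.

## What (the `T`-level evaluations of [PerrinRiou1998AIF] p. 1252, in the tree's pointwise currency)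

THEOREM C needs the congruence `x_{rq}(φ) − Z_q x_r(φ) ∈ (φ − 1)T` at a Frobenius `φ` above `q`
(skel STATUS v8).  Perrin-Riou proves it by ascending `n` steps in the `p`-tower to the layer where
the prime `λ ∣ q` is inert of degree `M = pⁿ` (generated by `φ`), evaluating three norm relations
there, and dividing by `q − 1` thanks to `(φ^M − 1)T ⊆ M(φ − 1)T` (file C0a).  This file supplies
the three evaluations and the final division as pure statements about a topological representation
`X` (`= T`) of `G`, subgroups `V₁ ≤ V₀` (the `p`-levels `r + n ≤ r`), and `φ ∈ V₀` with `φ^M ∈ V₁`: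
* `apply_pow_eq_sum_rho_pow_apply` — a cocycle on the powers of one element:
  `x(φ^M) = Σ_{i<M} φ^i x(φ)`;
* `eq_add_rho_sub_of_sum_conj_eq` — **(2.2.6)–(2.2.7)**: if the `p`-direction norm relation
  `Cor x₁ = x₀` holds on `V₁` with witness `e` (`Σ_{i<M} φ^i·x₁ = x₀|_{V₁} + ∂e`, evaluated at the
  single element `φ^M ∈ V₁`), and `φ^M − 1` is injective on `X` (no eigenvalue of `φ` is an `M`-th
  root of unity — for `T_pE` the Weil bound), then `x₁(φ^M) = x₀(φ) + (φ − 1)e` EXACTLY;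
* `exists_sub_eq_rho_sub_of_ascent` — **(2.2.8) ÷ (q − 1)**: from
  `N_q y₁' − N_q Z y₁ = (Φ^M − 1) b` (the tame relation of the high layer evaluated at `φ^M`, with
  `P_q(Fr⁻¹) = N_q Z` as operators), the two transports `y₁' = y₀' + (Φ−1)e'`, `y₁ = y₀ + (Φ−1)e`,
  the room `(Φ^M − 1)b = (Φ − 1)(pⁿ s)` (C0a), `N_q = p^r d` with `d` invertible, `r ≤ n`, and no
  `p`-torsion: `y₀' − Z y₀ ∈ (Φ − 1)X` — the congruence one level down.
File C0c descends from `p`-level `r` to `p`-level `0` (Mackey sum); C0d packages everything for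
`T_pE` over `cyclotomicLevelsRat` (`r = v_p(q^f − 1)`, the Kolyvagin conditions give
`(Frob_q − 1)² ≡ 0 mod p`).

References: B. Perrin-Riou, Ann. Inst. Fourier 48 (1998), Prop. 2.2.5 (ii) and its proof
p. 1252–1253; K. Rubin, in LNM 1716 (1999), Prop. 8.6.
-/

noncomputable section

open CategoryTheory Function Finset Field
open Literature.NumberTheory.GaloisRepresentations
open Literature.NumberTheory.EllipticCurves (subgroupConj subgroupConj_apply_coe subgroupConj_one)

universe u v

namespace Summit.BirchSwinnertonDyer.Rank1Residual.GaloisImage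

namespace Congruence

section Ascent

variable {R : Type v} [CommRing R] [TopologicalSpace R]
variable {G : Type u} [Group G] [TopologicalSpace G] [IsTopologicalGroup G]
variable (X : TopRep.{u} R G)

/-! ### §1 A cocycle on the powers of one element -/

omit [IsTopologicalGroup G] in
/-- **A cocycle on powers**: for `φ ∈ V`, `x(φ^M) = Σ_{i<M} φ^i x(φ)`. [folklore] -/
theorem apply_pow_eq_sum_rho_pow_apply (V : Subgroup G) (x : contOneCocycles (subgroupRep X V))
    (φ : V) (M : ℕ) :
    x.1 (φ ^ M) = ∑ i ∈ range M, X.ρ ((φ : G) ^ i) (x.1 φ) := by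
  induction M with
  | zero => rw [pow_zero, sum_range_zero]; exact contOneCocycles.apply_one _
  | succ M ih => rw [pow_succ, subgroup_cocycle_mul, ih, sum_range_succ, Subgroup.coe_pow]

omit [TopologicalSpace G] [IsTopologicalGroup G] in
/-- Telescoping for the action of powers: `Σ_{i<M} (φ^{i+1} v − φ^i v) = φ^M v − v`, i.e.
`(φ − 1) Σ_{i<M} φ^i v = φ^M v − v`. [folklore] -/
theorem rho_sum_rho_pow_sub (φ : G) (M : ℕ) (v : X) :
    X.ρ φ (∑ i ∈ range M, X.ρ (φ ^ i) v) - ∑ i ∈ range M, X.ρ (φ ^ i) v = X.ρ (φ ^ M) v - v := by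
  rw [map_sum, ← sum_sub_distrib]
  have h : ∀ i ∈ range M, X.ρ φ (X.ρ (φ ^ i) v) - X.ρ (φ ^ i) v =
      X.ρ (φ ^ (i + 1)) v - X.ρ (φ ^ i) v := fun i _ => by rw [← ρ_mul_apply, ← pow_succ']
  rw [sum_congr rfl h, sum_range_sub (fun i => X.ρ (φ ^ i) v), pow_zero, map_one]
  rfl

/-! ### §2 (2.2.6)–(2.2.7): evaluating the `p`-direction norm relation at `φ^M` -/

/-- **Transport along the `p`-tower** ([PerrinRiou1998AIF] (2.2.6)–(2.2.7)).  Let `V₁ ≤ V₀`,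
`φ ∈ V₀` with `φ^M ∈ V₁`, `x₁` a `V₁`-cocycle and `x₀` a `V₀`-cocycle such that the norm relation
`Σ_{i<M} φ^i · x₁ = x₀|_{V₁} + ∂e` holds AT the element `φ^M` (this is the restriction to `V₁` of
`Cor_{V₀/V₁} x₁ = x₀` for the layer `V₀/V₁ = ⟨φ⟩` of order `M`), and suppose `φ^M − 1` is
injective on `X`.  Then `x₁(φ^M) = x₀(φ) + (φ − 1) e`.  (Since `φ` commutes with its powers the
conjugates `φ^{-i} φ^M φ^i` are all `φ^M`, the left side is `Σ φ^i x₁(φ^M)`; the right side is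
`Σ φ^i x₀(φ) + (φ^M − 1)e` by `apply_pow_eq_sum_rho_pow_apply`; apply `φ − 1` and telescope.)
[cite: PerrinRiou1998AIF, Prop. 2.2.5 (ii) proof, (2.2.6)–(2.2.7)] -/
theorem eq_add_rho_sub_of_sum_conj_eq {V₀ V₁ : Subgroup G} [V₁.Normal] (x₁ : contOneCocycles (subgroupRep X V₁))
    (x₀ : contOneCocycles (subgroupRep X V₀)) {φ : G} (hφ : φ ∈ V₀) {M : ℕ} (hφM : φ ^ M ∈ V₁)
    (e : X)
    (hcor : ∑ i ∈ range M, X.ρ (φ ^ i) (x₁.1 (subgroupConj V₁ (φ ^ i) ⟨φ ^ M, hφM⟩)) =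
      x₀.1 ⟨φ ^ M, V₀.pow_mem hφ M⟩ + (X.ρ (φ ^ M) e - e))
    (hinj : Function.Injective fun v : X => X.ρ (φ ^ M) v - v) :
    x₁.1 ⟨φ ^ M, hφM⟩ = x₀.1 ⟨φ, hφ⟩ + (X.ρ φ e - e) := by
  -- the conjugates of `φ^M` by powers of `φ` are `φ^M`
  have hconj : ∀ i, subgroupConj V₁ (φ ^ i) ⟨φ ^ M, hφM⟩ = ⟨φ ^ M, hφM⟩ := fun i =>
    Subtype.ext (by
      simp only [subgroupConj_apply_coe]
      rw [← zpow_natCast φ i, ← zpow_natCast φ M, ← zpow_neg, ← zpow_add, ← zpow_add]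
      congr 1; ring)
  simp only [hconj] at hcor
  have hpow : x₀.1 ⟨φ ^ M, V₀.pow_mem hφ M⟩ = ∑ i ∈ range M, X.ρ (φ ^ i) (x₀.1 ⟨φ, hφ⟩) := by
    have h := apply_pow_eq_sum_rho_pow_apply X V₀ x₀ ⟨φ, hφ⟩ M
    rw [← h]; rfl
  rw [hpow] at hcor
  -- `w := x₁(φ^M) − x₀(φ) − (φ−1)e` satisfies `Σ φ^i w = 0`, hence `(φ^M − 1) w = 0`
  set w : X := x₁.1 ⟨φ ^ M, hφM⟩ - (x₀.1 ⟨φ, hφ⟩ + (X.ρ φ e - e)) with hw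
  have hsum : ∑ i ∈ range M, X.ρ (φ ^ i) w = 0 := by
    simp only [hw, map_sub, map_add, sum_sub_distrib, sum_add_distrib, hcor]
    have ht : ∑ i ∈ range M, (X.ρ (φ ^ i) (X.ρ φ e) - X.ρ (φ ^ i) e) = X.ρ (φ ^ M) e - e := by
      have h : ∀ i ∈ range M, X.ρ (φ ^ i) (X.ρ φ e) - X.ρ (φ ^ i) e =
          X.ρ (φ ^ (i + 1)) e - X.ρ (φ ^ i) e := fun i _ => by rw [← ρ_mul_apply, ← pow_succ]
      rw [sum_congr rfl h, sum_range_sub (fun i => X.ρ (φ ^ i) e), pow_zero, map_one]; rfl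
    rw [← sum_sub_distrib, ht]
    abel
  have hkill : X.ρ (φ ^ M) w - w = 0 := by
    rw [← rho_sum_rho_pow_sub X φ M w, hsum, map_zero, sub_zero]
  have hw0 : w = 0 := hinj (by simp only [hkill, map_zero, sub_zero])
  rw [hw, sub_eq_zero] at hw0
  exact hw0

/-! ### §3 (2.2.8) divided by `q − 1` -/

omit [TopologicalSpace G] [IsTopologicalGroup G] in
/-- **The division step** ([PerrinRiou1998AIF] p. 1252–1253: "grâce à l'inclusion
`(φ_λ^M − 1)T ⊂ (l − 1)(φ_λ − 1)T`").  In an `A`-module `X` without `p`-torsion let `Φ, Z` be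
commuting endomorphisms and suppose: the tame relation of the high layer evaluated at `φ^M`,
`N • y₁' − N • Z y₁ = (Φ^M − 1) b`; the two transports `y₁' = y₀' + (Φ − 1) e'`,
`y₁ = y₀ + (Φ − 1) e`; the room `(Φ^M − 1) b = (Φ − 1)(pⁿ • s)` (file C0a); `N = p^r d` with
`d` invertible on `X` and `r ≤ n`.  Then `y₀' − Z y₀ ∈ (Φ − 1) X`: the congruence one level down.
[cite: PerrinRiou1998AIF, Prop. 2.2.5 (ii) proof, (2.2.8)] -/
theorem exists_sub_eq_sub_one_apply_of_ascent {A : Type*} [CommRing A] {Y : Type*} [AddCommGroup Y]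
    [Module A Y] (p : ℕ) (htors : ∀ y : Y, p • y = 0 → y = 0) (Φ Z : Module.End A Y)
    (hcomm : Commute Φ Z) {N r n d : ℕ} (hN : N = p ^ r * d) (hrn : r ≤ n) (d' : A)
    (hd : ∀ y : Y, d • d' • y = y) (M : ℕ) (y₀ y₀' y₁ y₁' e e' b s : Y)
    (htame : N • y₁' - N • Z y₁ = (Φ ^ M - 1) b)
    (htr' : y₁' = y₀' + (Φ - 1) e') (htr : y₁ = y₀ + (Φ - 1) e)
    (hroom : (Φ ^ M - 1) b = (Φ - 1) (p ^ n • s)) :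
    ∃ w : Y, y₀' - Z y₀ = (Φ - 1) w := by
  -- no `p^r`-torsion
  have htors' : ∀ (k : ℕ) (y : Y), p ^ k • y = 0 → y = 0 := by
    intro k; induction k with
    | zero => intro y hy; rwa [pow_zero, one_smul] at hy
    | succ k ih => intro y hy; rw [pow_succ, mul_smul] at hy; exact htors _ (ih _ hy)
  have hZΦ : ∀ y : Y, Z ((Φ - 1) y) = (Φ - 1) (Z y) := fun y => by
    have h := congrArg (fun F : Module.End A Y => F y) (hcomm.sub_left (Commute.one_left Z)).eq
    simp only [Module.End.mul_apply] at h
    exact h.symm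
  -- `p^r • (d • (y₀' − Z y₀) − (Φ−1)(p^{n−r} s − d e' + d Z e)) = 0`
  refine ⟨d' • (p ^ (n - r) • s - d • e' + d • Z e), ?_⟩
  have hpn : p ^ n = p ^ r * p ^ (n - r) := by rw [← pow_add, Nat.add_sub_cancel' hrn]
  have h1 := htame
  rw [hroom, htr', htr, hN, hpn] at h1
  simp only [map_add, map_nsmul, smul_add, mul_smul, hZΦ] at h1
  have key : p ^ r • (d • (y₀' - Z y₀)) = p ^ r • (Φ - 1) (p ^ (n - r) • s - d • e' + d • Z e) := by
    simp only [map_add, map_sub, map_nsmul, smul_add, smul_sub]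
    linear_combination (norm := module) h1
  have key' : d • (y₀' - Z y₀) = (Φ - 1) (p ^ (n - r) • s - d • e' + d • Z e) :=
    sub_eq_zero.mp (htors' r _ (by rw [smul_sub, sub_eq_zero]; exact key))
  calc y₀' - Z y₀ = d • d' • (y₀' - Z y₀) := (hd _).symm
    _ = d' • (d • (y₀' - Z y₀)) := smul_comm _ _ _
    _ = (Φ - 1) (d' • (p ^ (n - r) • s - d • e' + d • Z e)) := by
        rw [key', map_smul]

end Ascent

end Congruence

end Summit.BirchSwinnertonDyer.Rank1Residual.GaloisImage

end
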